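import Mathlib.Tactic.Linarith
import Mathlib.Tactic.NormNum
import Mathlib.Tactic.Ring
import HarnessLib

/-!
# The (0,1) cell of the ι-window, XXXVI: the product ground `B₁ × B₂`, XXIII — THE CORNER VII: LEMMA SOC-μ and THEOREM II-VOID-μ
# (report [XXXVI] `H2-ZERO-ONE-36.md` §§2–3): arithmetic shadows

Family `hodge`, b2b cell `hweil` (helper of item stmt-HodgeConjecture-2524). Report
`run/shared/lean/b2b/hodge-weil/b2b-hweil-pv1-g48/H2-ZERO-ONE-36.md` ([XXXVI]). Context ([XXXIV] X² / TOR⁺, [XXXV] SOC): for a corner sheaf `F` whose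
H-half is a Hartshorne–Serre partner with degeneracy curve `W′` and surface divisor `D′ ⊂ S` of bidegree `(v′, h′)`,
`e₁^ι(F) ≥ MAIN − Λ⁺ − OB + h¹(M_Y|_{W′})^+`. LEMMA SOC-μ of [XXXVI] identifies the `x̃`-socle of `ω_{W′}(2S)` with `ω_{D′}(2S)` and counts its
invariant sections PER UNIT OF MULTIPLICITY: an S-line of multiplicity `μ` in `D′` carries `K₁³ ⊗ ℂ[t]/(t^μ)` (`h⁰ = 5μ`), whose invariant part is
`5μ` for a free ι-pair and at least `c(μ) := ⌈μ/2⌉·1 + ⌊μ/2⌋·4` for an ι-fixed line (`t` odd, `h⁰(K₁³)^± = (1,4)`); an ι-fixed vertical S-fibre of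
multiplicity `μ` carries at least `μ·⌈(h′ − 2)/2⌉` when `D′` has no bi-dominant part. The theorems below are the integer minimisations behind
THEOREM II-VOID-μ's closure of the type-1 cells `(10,3,20,12)`, `(9,3,19,10)`, `(9,4,19,14)` and the one-block bookkeeping of PROPOSITION
GRAPH-LINE / LEMMA LAYERS. None of the theorems claims geometry. HONEST FRAMING: census work inside the ladder's H2 test ((0,1) cell) on the SPECIAL
fourfold `X₀`; nothing here is a rung; no case of the Hodge conjecture is proved; no statement of [Markman 2025] / [Perry 2026] / [EdGFS 2025] is used.
-/

-- mandated namespace `Summit.HodgeConjecture.HodgeConjecture.…` (Problem = Summit) trips `linter.dupNamespace`; the lakefile disables it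
-- tree-wide (weak option), restated here so stand-alone elaboration is warning-free too.
set_option linter.dupNamespace false

namespace Summit.HodgeConjecture.HodgeConjecture.WeilTypeLadder

section ProductGroundTwentyThree

/-- **[XXXVI] 2.1 (c) (LEMMA SOC-μ, the fixed-line count).** `c(μ) = ⌈μ/2⌉ + 4⌊μ/2⌋ = (μ+1)/2 + 4(μ/2)` (natural division): values `1, 5, 6, 10, 11, 15`
for `μ = 1 … 6`; `c(0) = 0`; `2c(μ) ≥ 5μ − 3` and `c(μ) ≥ 2μ − 1` for every `μ`; a free pair carrying `2μ` units gives `5μ`. [`decide` / `omega`] -/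
theorem pg23_socmu_line_counts :
    ((0 + 1) / 2 + 4 * (0 / 2) = 0 ∧ (1 + 1) / 2 + 4 * (1 / 2) = 1 ∧ (2 + 1) / 2 + 4 * (2 / 2) = 5 ∧ (3 + 1) / 2 + 4 * (3 / 2) = 6 ∧
      (4 + 1) / 2 + 4 * (4 / 2) = 10 ∧ (5 + 1) / 2 + 4 * (5 / 2) = 11 ∧ (6 + 1) / 2 + 4 * (6 / 2) = 15) ∧
    (∀ μ : ℕ, 5 * μ ≤ 2 * ((μ + 1) / 2 + 4 * (μ / 2)) + 3 ∧ 2 * μ ≤ (μ + 1) / 2 + 4 * (μ / 2) + 1) := by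
  refine ⟨by decide, fun μ => ⟨by omega, by omega⟩⟩

/-- **[XXXVI] 3.2 (a) (THEOREM II-VOID-μ, cell `(10,3,20,12)`: `v′ = 0`, `h′ = 9`).** Write each fixed-line multiplicity as `μ = 2q + o`,
`o ∈ {0,1}` (`μ = 0` = line absent); then `c(μ) = (μ+1)/2 + 4(μ/2) = 5q + o`. Every ι-invariant configuration of nine line-units on at most six ι-fixed
lines plus free pairs carrying `2p` units (`Σ(2qᵢ + oᵢ) + 2p = 9`) has `Σ c(μᵢ) + 5p = 5(Σqᵢ + p) + Σoᵢ ≥ 15` (the number of odd `μᵢ` is odd, hence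
`≤ 5`); with `MAIN = 156` and `Λ⁺ = 18·9 = 162`: `e₁^ι ≥ 156 − 162 + 15 = 9 ≥ 2` — VOID. [`omega`] -/
theorem pg23_socmu_cell_twelve :
    (∀ μ : ℕ, (μ + 1) / 2 + 4 * (μ / 2) = 5 * (μ / 2) + μ % 2 ∧ μ = 2 * (μ / 2) + μ % 2 ∧ μ % 2 ≤ 1) ∧
    (∀ q₁ q₂ q₃ q₄ q₅ q₆ o₁ o₂ o₃ o₄ o₅ o₆ p : ℕ, o₁ ≤ 1 → o₂ ≤ 1 → o₃ ≤ 1 → o₄ ≤ 1 → o₅ ≤ 1 → o₆ ≤ 1 →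
      (2 * q₁ + o₁) + (2 * q₂ + o₂) + (2 * q₃ + o₃) + (2 * q₄ + o₄) + (2 * q₅ + o₅) + (2 * q₆ + o₆) + 2 * p = 9 →
      15 ≤ (5 * q₁ + o₁) + (5 * q₂ + o₂) + (5 * q₃ + o₃) + (5 * q₄ + o₄) + (5 * q₅ + o₅) + (5 * q₆ + o₆) + 5 * p) ∧
    ((156 : ℤ) - 18 * 9 + 15 = 9 ∧ (2 : ℤ) ≤ 9) := by
  refine ⟨fun μ => ⟨by omega, by omega, by omega⟩, ?_, by norm_num⟩
  intro q₁ q₂ q₃ q₄ q₅ q₆ o₁ o₂ o₃ o₄ o₅ o₆ p h₁ h₂ h₃ h₄ h₅ h₆ h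
  omega

/-- **[XXXVI] 3.2 (b) (THEOREM II-VOID-μ, cells `(9,3,19,10)` and `(9,4,19,14)`: `v′ = 1`).** In the notation of 3.2 (a): seven line-units give
`Σ c(μᵢ) + 5p ≥ 10`, ten give `≥ 16`; the single ι-fixed vertical S-fibre gives `≥ ⌈(h′ − 2)/2⌉ = 3` resp. `4` (layers of degree `h′ + 2` on `C₂`,
`h⁰ = h′ + 1`, Lefschetz `|L| ≤ 3`); margins ([XXXIV] 13.2 / [XXXV] PART 4): `−8 + 13 = 5 ≥ 2` and `−11 + 20 = 9 ≥ 2` — both VOID. [`omega`] -/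
theorem pg23_socmu_cells_nine :
    (∀ q₁ q₂ q₃ q₄ q₅ q₆ o₁ o₂ o₃ o₄ o₅ o₆ p : ℕ, o₁ ≤ 1 → o₂ ≤ 1 → o₃ ≤ 1 → o₄ ≤ 1 → o₅ ≤ 1 → o₆ ≤ 1 →
      (2 * q₁ + o₁) + (2 * q₂ + o₂) + (2 * q₃ + o₃) + (2 * q₄ + o₄) + (2 * q₅ + o₅) + (2 * q₆ + o₆) + 2 * p = 7 →
      10 ≤ (5 * q₁ + o₁) + (5 * q₂ + o₂) + (5 * q₃ + o₃) + (5 * q₄ + o₄) + (5 * q₅ + o₅) + (5 * q₆ + o₆) + 5 * p) ∧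
    (∀ q₁ q₂ q₃ q₄ q₅ q₆ o₁ o₂ o₃ o₄ o₅ o₆ p : ℕ, o₁ ≤ 1 → o₂ ≤ 1 → o₃ ≤ 1 → o₄ ≤ 1 → o₅ ≤ 1 → o₆ ≤ 1 →
      (2 * q₁ + o₁) + (2 * q₂ + o₂) + (2 * q₃ + o₃) + (2 * q₄ + o₄) + (2 * q₅ + o₅) + (2 * q₆ + o₆) + 2 * p = 10 →
      16 ≤ (5 * q₁ + o₁) + (5 * q₂ + o₂) + (5 * q₃ + o₃) + (5 * q₄ + o₄) + (5 * q₅ + o₅) + (5 * q₆ + o₆) + 5 * p) ∧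
    ((7 + 1 - 3 + 1) / 2 = 3 ∧ (10 + 1 - 3 + 1) / 2 = 4 ∧ (-8 : ℤ) + (10 + 3) = 5 ∧ (-11 : ℤ) + (16 + 4) = 9) := by
  refine ⟨?_, ?_, by norm_num⟩
  · intro q₁ q₂ q₃ q₄ q₅ q₆ o₁ o₂ o₃ o₄ o₅ o₆ p h₁ h₂ h₃ h₄ h₅ h₆ h
    omega
  · intro q₁ q₂ q₃ q₄ q₅ q₆ o₁ o₂ o₃ o₄ o₅ o₆ p h₁ h₂ h₃ h₄ h₅ h₆ h
    omega

/-- **[XXXVI] 4.1–4.2 (PROPOSITION GRAPH-LINE, the divisor chain of a one-`x̃`-block S-line).** With `ρ = 2n₃ − n′` (type 1, `n₃ = 10`: `ρ = 10`):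
`deg D_{m−1} = 2m + 2ρ`, `Σ_j deg D_j = m(m + ρ)`, `ε₁ (m − 1) ≤ 2m + 20`. Hence `ε₁ ≤ 9` at `m = 4`, `ε₁ ≤ 3` for `m ≥ 13`, `ε₁ ≤ 2` for `m ≥ 24`;
`2m + 20 = 2(m − 1) + 22`, so the monomial chains `D_j = jD₁` (which need `(m − 1) ∣ (2m + 20)`) have `(m − 1) ∣ 22`, `m ∈ {2, 3, 12, 23}`, with
`ε₁ = 24, 13, 4, 3` — the first two are [XXXV] RIB-LINE's `24` and `13`; the plain `m = 4` chain `(0,0,28,28)` has layer degrees `(0,−2,24,22)`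
summing to `11·4`. [`omega` / `norm_num`] -/
theorem pg23_graph_line_chain :
    (∀ m e : ℕ, 4 ≤ m → e * (m - 1) ≤ 2 * m + 20 → e ≤ 9) ∧
    (∀ m e : ℕ, 13 ≤ m → e * (m - 1) ≤ 2 * m + 20 → e ≤ 3) ∧
    (∀ m e : ℕ, 24 ≤ m → e * (m - 1) ≤ 2 * m + 20 → e ≤ 2) ∧
    (∀ m : ℕ, 2 ≤ m → 2 * m + 20 = 2 * (m - 1) + 22) ∧
    ((2 * 2 + 20) / (2 - 1) = 24 ∧ (2 * 3 + 20) / (3 - 1) = 13 ∧ (2 * 12 + 20) / (12 - 1) = 4 ∧ (2 * 23 + 20) / (23 - 1) = 3 ∧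
      22 % (2 - 1) = 0 ∧ 22 % (3 - 1) = 0 ∧ 22 % (12 - 1) = 0 ∧ 22 % (23 - 1) = 0) ∧
    ((0 : ℤ) + 0 + 28 + 28 = 4 * (4 + 10) ∧ (0 : ℤ) + (-2) + 24 + 22 = 11 * 4 ∧ (2 : ℤ) * 4 + 20 = 28) := by
  refine ⟨fun m e hm h => ?_, fun m e hm h => ?_, fun m e hm h => ?_, fun m hm => by omega, by norm_num, by norm_num⟩
  · by_contra hc
    have hc' : 10 ≤ e := by omega
    have : 10 * (m - 1) ≤ e * (m - 1) := Nat.mul_le_mul_right _ hc'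
    omega
  · by_contra hc
    have hc' : 4 ≤ e := by omega
    have : 4 * (m - 1) ≤ e * (m - 1) := Nat.mul_le_mul_right _ hc'
    omega
  · by_contra hc
    have hc' : 3 ≤ e := by omega
    have : 3 * (m - 1) ≤ e * (m - 1) := Nat.mul_le_mul_right _ hc'
    omega

/-- **[XXXVI] 4.4 (LEMMA LAYERS, the per-pair gain of an isolated one-block S-line).** With `A = Ξ(−2S)` (deg 18, `h⁰ = 17`), `B = Ξ(−S)` (deg 20,
`h⁰ = 19`), second loss layer `B(−D₁)` of degree `20 − ε₁` (`h⁰ ≤ 19 − ε₁` for `ε₁ ≤ 17`, `≤ 2` beyond), socle `K₁³` (`5`) and sub-socle layer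
`K₁⁴(−D₁)` of degree `8 − ε₁` (`h⁰ ≥ 7 − ε₁` for `ε₁ ≤ 5`, `≥ 0` else): the gain over `MAIN − Λ⁺` of a free pair,
`5 + h⁰(K₁⁴(−D₁)) + (19 − h⁰(B(−D₁)))`, is `≥ 11` for every `ε₁`, `= 12` on `ε₁ ≤ 5`. [`omega`] -/
theorem pg23_layers_gain :
    (∀ e : ℕ, e ≤ 5 → 5 + (7 - e) + (19 - (19 - e)) = 12) ∧
    (∀ e : ℕ, 6 ≤ e → e ≤ 17 → 11 ≤ 5 + 0 + (19 - (19 - e))) ∧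
    (∀ e : ℕ, 18 ≤ e → 11 ≤ 5 + 0 + (19 - 2)) ∧
    ((18 : ℤ) + 1 - 2 = 17 ∧ (20 : ℤ) + 1 - 2 = 19 ∧ (6 : ℤ) + 1 - 2 = 5 ∧ (8 : ℤ) + 1 - 2 = 7) := by
  refine ⟨fun e he => by omega, fun e h6 h17 => by omega, fun e h => by omega, by norm_num⟩

/-- **[XXXVI] 4.5 (SHORT BLOCKS) and 3.3 (the residual counts).** A line with `μ` `x̃`-blocks of which `μ₁ ≤ μ` have size one loses at most
`17μ + 19(μ − μ₁) = 36μ − 19μ₁` sections per free pair and at most `18(μ − μ₁) + 10μ₁ = 18μ − 8μ₁` invariant sections per fixed line;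
the type-1 residual: `240 − 14 = 226 = 5 + 21 + 50 + 150`. [`omega` / `norm_num`] -/
theorem pg23_short_blocks_and_counts :
    (∀ μ μ₁ : ℕ, μ₁ ≤ μ → 17 * μ + 19 * (μ - μ₁) = 36 * μ - 19 * μ₁ ∧ 18 * (μ - μ₁) + 10 * μ₁ = 18 * μ - 8 * μ₁) ∧
    ((240 : ℕ) - 14 = 226 ∧ (5 : ℕ) + 21 + 50 + 150 = 226 ∧ (241 : ℕ) - 1 = 240) := by
  refine ⟨fun μ μ₁ h => ⟨by omega, by omega⟩, by norm_num⟩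

end ProductGroundTwentyThree

end Summit.HodgeConjecture.HodgeConjecture.WeilTypeLadder
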